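import Summits.BirchSwinnertonDyer.BirchSwinnertonDyer.Theorems.ResidualThetaTransportAtTwoSignedMuSeedAtTwoPlusTowerStaircaseReading
import Summits.BirchSwinnertonDyer.BirchSwinnertonDyer.Theorems.ResidualThetaTransportAtTwoLambdaHerbrandCount
import Mathlib.GroupTheory.PGroup
import HarnessLib

/-!
# The TOWER STAIRCASE (part 3, GROWTH): the layer counts of a finitely generated `Λ = ℤ_p⟦T⟧`-module are powers of `p`
# and grow EXACTLY GEOMETRICALLY from some step on — `#(X/(p,T^{j+1})X) = p^r · #(X/(p,T^j)X)` for all large `j`, with an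
# integer slope `r ≥ 0`, `r = 0 ⟺ X/pX` finite — the structure-free `p`-RANK THEOREM of the tower
# (crux Kμ⁺ `SignedMuVanishingAtTwoPlus` stmt-BirchSwinnertonDyer-20689, seed `SignedMuSeedAtTwoPlus` stmt-21438, route `ResidualThetaTransportAtTwo`)

Cell `bsd-wall`, width seat `bsd-wall-rtt-p4-w2` (g12). THEOREMS ONLY (no `def`, no named fact, no `sorry`); pure commutative
algebra over `Λ = ℤ_p⟦T⟧` for EVERY prime `p`; `--supports` the crux as a helper; nothing about any curve is asserted; BSD is not
proved by this. Sequel of `…TowerStaircase` (part 1: the unit-step indices `e_j = [T^j N : T^{j+1} N]` of `N = X/pX` satisfy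
`e_{j+1} ∣ e_j`) and `…TowerStaircaseReading` (part 2: freezing, `λ`-reading, layers). In dimensions `c j = p^{d_j}` this file is
the statement «`d_{j+1} − d_j` is a non-increasing sequence of natural numbers, hence eventually an integer constant `r`», i.e.
**`d_n = r · p^n + O(1)` along the layers `n ↦ p^n` with `r ∈ ℕ`, and `r = 0` exactly when `X` is torsion with `μ(X) = 0`** —
the `p`-rank companion of Iwasawa's `e_n = μ p^n + λ n + ν`, proved here WITHOUT the structure theorem (no pseudo-isomorphism,
no elementary modules): only Nakayama, the staircase, and «a finite group killed by `p` has `p`-power order».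

* §1 numerics: a positive sequence antitone for divisibility is eventually constant (`exists_forall_eq_of_dvd`); the closed
  form of eventually-geometric sequences (`eq_mul_pow_of_forall_succ_eq`).
* §2 `exists_natCard_layer_eq_pow` — every layer count `#(X/(p,T^j)X)` is a power of `p` (the quotient is killed by `p`).
* §4 **`natCard_layer_eq_pow_lambdaInvariant_mul_of_lt`** — the frozen value after one slack block IS `p^{λ(X)} · #X[p]`
  (RTT's Herbrand count): in dimensions the stationary `p`-rank is `λ(X) + dim X[p]`.
* §3 **`exists_eventually_geometric`** — for `X` f.g. over `Λ` with counts `c`: `∃ j₀ r, ∀ j ≥ j₀, c (j+1) = p^r · c j`, and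
  `r = 0 ↔ X/pX` finite (`↔ X` torsion `∧ μ(X) = 0`, tree `TowerGap.finite_modP_iff_isTorsion_and_mu_eq_zero`); `p^r ∣ c 1 = #(X/𝔪X)`
  (the slope never exceeds the number of generators); closed form `c j = c j₀ · p^{r (j − j₀)}` (`natCard_layer_eq_mul_pow`) and the
  layer form **`c (p^(n+1)) = p^{r (p^{n+1} − p^n)} · c (p^n)`** for `p^n ≥ j₀` (`natCard_layer_pow_succ_eq`): the `p`-rank grows by
  EXACTLY `r (p^{n+1} − p^n)` per layer from some layer on.

Reading for the line: the three possible long-run behaviours of a census tower's `d_n = rk_p A_n` are «frozen» (`r = 0`, `μ = 0`),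
or «`d_{n+1} − d_n = r (p^{n+1} − p^n)` exactly with `1 ≤ r ≤ g`» (`g = d im X/𝔪X`); for 406203s1 (`g = 1`) the tower is frozen or
`d_n = 2^n + O(1)` with equality of increments from some layer on — no third option. (Arithmetic identification `A_n/2A_n ≅ X/(2,ω_n)X`
NOT formalised, as before.)

References: [Washington1997] §13.2–13.3 (Thm. 13.13, Lemma 13.16, Props. 13.19–13.22); [Fukuda1994] Thm. 1; [NeukirchSchmidtWingberg2008]
(5.3.17); [Matsumura1987] §13 (Hilbert–Samuel functions).
-/

set_option autoImplicit false
set_option linter.dupNamespace false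

noncomputable section

open scoped Classical Pointwise

open Literature.NumberTheory.EllipticCurves Summit.BirchSwinnertonDyer.Rank1Residual.X5.TowerGap

namespace Summit.BirchSwinnertonDyer.BirchSwinnertonDyer.Theorems.SignedMuAtTwo.TowerStaircase

/-! ## §1 Numerics: divisibility-antitone sequences are eventually constant; eventually geometric sequences -/

section Numerics

/-- A positive sequence of naturals with `e (j+1) ∣ e j` is eventually constant (it is antitone and bounded below). [folklore] -/
theorem exists_forall_eq_of_dvd {e : ℕ → ℕ} (hpos : ∀ j, 0 < e j) (hdvd : ∀ j, e (j + 1) ∣ e j) :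
    ∃ j₀, ∀ j, j₀ ≤ j → e j = e j₀ := by
  have hanti : Antitone e := antitone_nat_of_succ_le fun j => Nat.le_of_dvd (hpos j) (hdvd j)
  obtain ⟨j₀, hj₀⟩ : ∃ j₀, e j₀ = sInf (Set.range e) := by
    obtain ⟨j₀, h⟩ := Nat.sInf_mem (Set.range_nonempty e)
    exact ⟨j₀, h⟩
  refine ⟨j₀, fun j hj => le_antisymm (hanti hj) ?_⟩
  rw [hj₀]
  exact Nat.sInf_le ⟨j, rfl⟩

/-- In a divisibility-antitone sequence every later term divides every earlier term. [folklore] -/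
theorem dvd_of_le_of_dvd {e : ℕ → ℕ} (hdvd : ∀ j, e (j + 1) ∣ e j) {i j : ℕ} (hij : i ≤ j) : e j ∣ e i := by
  obtain ⟨k, rfl⟩ := Nat.exists_eq_add_of_le hij
  induction k with
  | zero => simp
  | succ k ih =>
    have h1 : e (i + k + 1) ∣ e (i + k) := hdvd (i + k)
    rw [← add_assoc]
    exact h1.trans (ih (Nat.le_add_right i k))

/-- Closed form of an eventually geometric sequence: `c (j+1) = e · c j` for `j ≥ j₀` gives `c j = c j₀ · e^(j − j₀)`. [folklore] -/
theorem eq_mul_pow_of_forall_succ_eq {c : ℕ → ℕ} {j₀ e : ℕ} (h : ∀ j, j₀ ≤ j → c (j + 1) = e * c j)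
    {j : ℕ} (hj : j₀ ≤ j) : c j = c j₀ * e ^ (j - j₀) := by
  obtain ⟨k, rfl⟩ := Nat.exists_eq_add_of_le hj
  rw [Nat.add_sub_cancel_left]
  induction k with
  | zero => simp
  | succ k ih =>
    rw [← add_assoc, h _ (Nat.le_add_right _ _), ih (Nat.le_add_right _ _), pow_succ]
    ring

/-- Between two indices past `j₀`: `c j' = c j · e^(j' − j)`. [folklore] -/
theorem eq_mul_pow_of_forall_succ_eq' {c : ℕ → ℕ} {j₀ e : ℕ} (h : ∀ j, j₀ ≤ j → c (j + 1) = e * c j)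
    {j j' : ℕ} (hj : j₀ ≤ j) (hjj' : j ≤ j') : c j' = c j * e ^ (j' - j) :=
  eq_mul_pow_of_forall_succ_eq (j₀ := j) (fun i hi => h i (hj.trans hi)) hjj'

end Numerics

/-! ## §2 The layer counts are powers of `p` -/

section Powers

variable (p : ℕ) [hp : Fact p.Prime] {M : Type*} [AddCommGroup M] [Module (IwasawaAlgebra p) M]

/-- `X/(p,T^j)X` is killed by `p`. [folklore] -/
theorem nsmul_p_quotient_towerIdeal (j : ℕ) (x : M ⧸ (towerIdeal p j • ⊤ : Submodule (IwasawaAlgebra p) M)) : p • x = 0 := by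
  induction x using Submodule.Quotient.induction_on with
  | H x =>
    have h : (Submodule.Quotient.mk (p • x) : M ⧸ (towerIdeal p j • ⊤ : Submodule (IwasawaAlgebra p) M)) = 0 := by
      rw [Submodule.Quotient.mk_eq_zero, ← Nat.cast_smul_eq_nsmul (IwasawaAlgebra p),
        ← map_natCast (PowerSeries.C (R := ℤ_[p])) p]
      refine Submodule.smul_mem_smul ?_ Submodule.mem_top
      exact le_sup_left (b := Ideal.span {(PowerSeries.X : IwasawaAlgebra p)} ^ j) (Ideal.mem_span_singleton_self _)
    exact h

/-- A finite additive group killed by the prime `p` has order a power of `p`. [folklore] -/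
theorem exists_natCard_eq_prime_pow {G : Type*} [AddCommGroup G] [Finite G] (hG : ∀ g : G, p • g = 0) :
    ∃ n : ℕ, Nat.card G = p ^ n := by
  have h : IsPGroup p (Multiplicative G) := fun g => ⟨1, by
    rw [pow_one, ← ofAdd_toAdd g, ← ofAdd_nsmul, hG, ofAdd_zero]⟩
  obtain ⟨n, hn⟩ := IsPGroup.iff_card.mp h
  exact ⟨n, hn⟩

variable [Module.Finite (IwasawaAlgebra p) M]

/-- **Every layer count `#(X/(p,T^j)X)` is a power of `p`.** [folklore] -/
theorem exists_natCard_layer_eq_pow (j : ℕ) :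
    ∃ d : ℕ, Nat.card (M ⧸ (towerIdeal p j • ⊤ : Submodule (IwasawaAlgebra p) M)) = p ^ d :=
  haveI := finite_quotient_towerIdeal p (M := M) j
  exists_natCard_eq_prime_pow p (nsmul_p_quotient_towerIdeal p j)

end Powers

/-! ## §3 Eventually EXACT geometric growth with an integer slope -/

section Growth

variable (p : ℕ) [hp : Fact p.Prime] {M : Type*} [AddCommGroup M] [Module (IwasawaAlgebra p) M]
  [Module.Finite (IwasawaAlgebra p) M]

/-- The unit-step indices of `X/pX` are eventually constant. [folklore] -/
theorem exists_forall_relIndex_eq :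
    ∃ j₀, ∀ j, j₀ ≤ j →
      (xPowSubmodule p (M ⧸ modPSubmodule p M) (j + 1)).toAddSubgroup.relIndex
          (xPowSubmodule p (M ⧸ modPSubmodule p M) j).toAddSubgroup =
        (xPowSubmodule p (M ⧸ modPSubmodule p M) (j₀ + 1)).toAddSubgroup.relIndex
          (xPowSubmodule p (M ⧸ modPSubmodule p M) j₀).toAddSubgroup :=
  exists_forall_eq_of_dvd
    (e := fun j => (xPowSubmodule p (M ⧸ modPSubmodule p M) (j + 1)).toAddSubgroup.relIndex
      (xPowSubmodule p (M ⧸ modPSubmodule p M) j).toAddSubgroup)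
    (fun j => Nat.pos_of_ne_zero (relIndex_layer_ne_zero p (M := M) j))
    (fun j => relIndex_xPowSubmodule_succ_dvd p (N := M ⧸ modPSubmodule p M) j)

/-- **The structure-free `p`-rank theorem (eventually exact geometric growth).** For a finitely generated `Λ`-module `X` with layer
counts `c j = #(X/(p,T^j)X)` there are `j₀` and an integer slope `r` with **`c (j+1) = p^r · c j` for every `j ≥ j₀`**, and
`r = 0 ↔ X/pX` is finite (`↔ X` torsion with `μ(X) = 0`). [cite: Washington1997, §13.3 (Lemma 13.16, Prop. 13.19)] -/
theorem exists_eventually_geometric (c : ℕ → ℕ)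
    (hc : ∀ j, c j = Nat.card (M ⧸ (towerIdeal p j • ⊤ : Submodule (IwasawaAlgebra p) M))) :
    ∃ j₀ r : ℕ, (∀ j, j₀ ≤ j → c (j + 1) = p ^ r * c j) ∧ (r = 0 ↔ Finite (M ⧸ modPSubmodule p M)) := by
  set N := M ⧸ modPSubmodule p M
  obtain ⟨j₀, hj₀⟩ := exists_forall_relIndex_eq p (M := M)
  set E := (xPowSubmodule p N (j₀ + 1)).toAddSubgroup.relIndex (xPowSubmodule p N j₀).toAddSubgroup with hE
  -- `E` is a power of `p`: `E · c j₀ = c (j₀+1)` is one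
  obtain ⟨d, hd⟩ := exists_natCard_layer_eq_pow p (M := M) (j₀ + 1)
  have hEdvd : E ∣ p ^ d := ⟨c j₀, by rw [← hd, hc, natCard_layer_succ_eq p j₀]⟩
  obtain ⟨r, -, hr⟩ := (Nat.dvd_prime_pow hp.out).mp hEdvd
  refine ⟨j₀, r, fun j hj => ?_, ?_⟩
  · rw [hc, hc, natCard_layer_succ_eq p j, hj₀ j hj, hr]
  · constructor
    · intro hr0
      rw [hr0, pow_zero] at hr
      -- a stall at `j₀`
      have hstall : Nat.card (M ⧸ (towerIdeal p (j₀ + 1) • ⊤ : Submodule (IwasawaAlgebra p) M)) =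
          Nat.card (M ⧸ (towerIdeal p j₀ • ⊤ : Submodule (IwasawaAlgebra p) M)) := by
        rw [natCard_layer_succ_eq p j₀, ← hE, hr, one_mul]
      exact (finite_modP_and_natCard_eq_of_stall p hstall).1
    · intro hfin
      -- `X/pX` finite ⟹ a slack block ⟹ frozen from `m + k` on ⟹ the eventual ratio is `1`
      obtain ⟨m, k, hlt⟩ := exists_card_quotient_lt_of_finite_modP p (M := M) hfin
      have hfr := finite_modP_and_natCard_eq_of_lt p c hc (m := m) (k := k) (by rw [hc, hc]; exact hlt)
      set j := max j₀ (m + k) with hj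
      have h1 : c (j + 1) = c j := by
        rw [hfr.2 (j + 1) (by omega), hfr.2 j (by omega)]
      have h2 : c (j + 1) = p ^ r * c j := by
        rw [hc, hc, natCard_layer_succ_eq p j, hj₀ j (by omega), hr]
      have hpos : 0 < c j := by rw [hc]; exact natCard_layer_pos p j
      have hpr : p ^ r = 1 := by
        have : p ^ r * c j = 1 * c j := by rw [← h2, h1, one_mul]
        exact Nat.eq_of_mul_eq_mul_right hpos this
      exact (Nat.pow_eq_one.mp hpr).resolve_left hp.out.one_lt.ne' |> fun h => h

/-- **The slope never exceeds the number of generators**: in `exists_eventually_geometric` one may take `p^r ∣ c 1 = #(X/𝔪X)`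
(the eventual unit-step index divides the first one, `e_0 = #(X/(p,T)X)`). [folklore] -/
theorem exists_eventually_geometric_dvd (c : ℕ → ℕ)
    (hc : ∀ j, c j = Nat.card (M ⧸ (towerIdeal p j • ⊤ : Submodule (IwasawaAlgebra p) M))) :
    ∃ j₀ r : ℕ, (∀ j, j₀ ≤ j → c (j + 1) = p ^ r * c j) ∧ (r = 0 ↔ Finite (M ⧸ modPSubmodule p M)) ∧ p ^ r ∣ c 1 := by
  obtain ⟨j₀, r, hgeo, hiff⟩ := exists_eventually_geometric p c hc
  refine ⟨j₀, r, hgeo, hiff, ?_⟩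
  set N := M ⧸ modPSubmodule p M
  -- `p^r = e_{j₀}` divides `e_0`, and `c 1 = e_0 · c 0 = e_0`
  have hpos : 0 < c j₀ := by rw [hc]; exact natCard_layer_pos p j₀
  have hE : p ^ r = (xPowSubmodule p N (j₀ + 1)).toAddSubgroup.relIndex (xPowSubmodule p N j₀).toAddSubgroup := by
    have h := hgeo j₀ le_rfl
    rw [hc, hc, natCard_layer_succ_eq p j₀, ← hc] at h
    exact (Nat.eq_of_mul_eq_mul_right hpos h).symm
  have hdvd := dvd_of_le_of_dvd (e := fun j => (xPowSubmodule p N (j + 1)).toAddSubgroup.relIndex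
    (xPowSubmodule p N j).toAddSubgroup) (fun j => relIndex_xPowSubmodule_succ_dvd p (N := N) j) (Nat.zero_le j₀)
  rw [← hE] at hdvd
  refine hdvd.trans ⟨c 0, ?_⟩
  rw [hc 1, hc 0, natCard_layer_succ_eq p 0]

omit hp in
/-- **Closed form**: with `j₀, r` as in `exists_eventually_geometric`, `c j = c j₀ · p^{r (j − j₀)}` for every `j ≥ j₀`. [folklore] -/
theorem natCard_layer_eq_mul_pow (c : ℕ → ℕ) {j₀ r : ℕ} (hgeo : ∀ j, j₀ ≤ j → c (j + 1) = p ^ r * c j)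
    {j : ℕ} (hj : j₀ ≤ j) : c j = c j₀ * p ^ (r * (j - j₀)) := by
  rw [pow_mul]
  exact eq_mul_pow_of_forall_succ_eq hgeo hj

/-- **Layer form**: with `j₀, r` as in `exists_eventually_geometric` and `p^n ≥ j₀`,
`c (p^(n+1)) = p^{r (p^{n+1} − p^n)} · c (p^n)` — the `p`-rank grows by EXACTLY `r (p^{n+1} − p^n)` between the layers `n` and
`n+1`, for every large `n`. [cite: Washington1997, §13.3] -/
theorem natCard_layer_pow_succ_eq (c : ℕ → ℕ) {j₀ r : ℕ} (hgeo : ∀ j, j₀ ≤ j → c (j + 1) = p ^ r * c j)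
    {n : ℕ} (hn : j₀ ≤ p ^ n) : c (p ^ (n + 1)) = p ^ (r * (p ^ (n + 1) - p ^ n)) * c (p ^ n) := by
  have hle : p ^ n ≤ p ^ (n + 1) := Nat.pow_le_pow_right hp.out.one_lt.le (Nat.le_succ n)
  rw [eq_mul_pow_of_forall_succ_eq' hgeo hn hle, pow_mul, mul_comm]

/-- **Trichotomy made a dichotomy.** For a finitely generated `Λ`-module the layer counts are EITHER eventually constant (`X/pX` finite:
`X` torsion with `μ(X) = 0`) OR eventually multiplied by the same `p^r ≥ p` at EVERY unit step — there is no intermediate long-run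
behaviour. [cite: Washington1997, §13.3] -/
theorem eventually_const_or_eventually_geometric (c : ℕ → ℕ)
    (hc : ∀ j, c j = Nat.card (M ⧸ (towerIdeal p j • ⊤ : Submodule (IwasawaAlgebra p) M))) :
    (∃ j₀, ∀ j, j₀ ≤ j → c j = c j₀) ∨
      (∃ j₀ r, 1 ≤ r ∧ ∀ j, j₀ ≤ j → c (j + 1) = p ^ r * c j) := by
  obtain ⟨j₀, r, hgeo, hiff⟩ := exists_eventually_geometric p c hc
  rcases Nat.eq_zero_or_pos r with hr | hr
  · left
    refine ⟨j₀, fun j hj => ?_⟩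
    have h := eq_mul_pow_of_forall_succ_eq hgeo hj
    rwa [hr, pow_zero, one_pow, mul_one] at h
  · exact Or.inr ⟨j₀, r, hr, hgeo⟩

/-- The eventual slope detects `μ`: `X` is `Λ`-torsion with `μ(X) = 0` iff the layer counts are eventually constant. (The tree's
`TowerGap.finite_modP_iff_isTorsion_and_mu_eq_zero` read through `exists_eventually_geometric`.) [cite: Washington1997, §13.2] -/
theorem isTorsion_and_mu_eq_zero_iff_eventually_const (c : ℕ → ℕ)
    (hc : ∀ j, c j = Nat.card (M ⧸ (towerIdeal p j • ⊤ : Submodule (IwasawaAlgebra p) M))) :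
    (Module.IsTorsion (IwasawaAlgebra p) M ∧ muInvariant p M = 0) ↔ ∃ j₀, ∀ j, j₀ ≤ j → c j = c j₀ := by
  rw [← finite_modP_iff_isTorsion_and_mu_eq_zero]
  constructor
  · intro hfin
    obtain ⟨m, k, hlt⟩ := exists_card_quotient_lt_of_finite_modP p (M := M) hfin
    have hfr := finite_modP_and_natCard_eq_of_lt p c hc (m := m) (k := k) (by rw [hc, hc]; exact hlt)
    exact ⟨m + k, fun j hj => by rw [hfr.2 j hj, hfr.2 (m + k) le_rfl]⟩
  · rintro ⟨j₀, hj₀⟩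
    have hstall : c (j₀ + 1) = c j₀ := hj₀ (j₀ + 1) (Nat.le_succ j₀)
    exact (finite_modP_and_natCard_eq_of_stall p (M := M) (j := j₀) (by rw [← hc, ← hc]; exact hstall)).1

end Growth

/-! ## §4 The frozen value, exactly: `c (m+k) = p^{λ(X)} · #X[p]` -/

section Frozen

variable (p : ℕ) [hp : Fact p.Prime] {M : Type*} [AddCommGroup M] [Module (IwasawaAlgebra p) M]
  [Module.Finite (IwasawaAlgebra p) M]

/-- **The frozen value IS `p^{λ(X)} · #X[p]`.** After one slack block `c (m+k) < p^k · c m` every later count equals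
`#(X/pX) = p^{λ(X)} · #X[p]` (`X[p]` = the kernel of multiplication by `p`; RTT's Herbrand count
`LambdaLowerBound.natCard_quotient_eq_pow_lambdaInvariant_mul_natCard_ker`). In `𝔽_p`-dimensions: the stationary value of `d_n` is
`λ(X) + dim X[p]` — `λ` plus the `p`-rank of the finite `ℤ_p`-torsion (the maximal finite `Λ`-submodule), settling the bookkeeping
«`λ = d_4`» (lead, cyclic case) vs «`λ + rk X_fin`» (census k2 g16 §2 (e)) in the kernel. [cite: Washington1997, §13.2] -/
theorem natCard_layer_eq_pow_lambdaInvariant_mul_of_lt (c : ℕ → ℕ)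
    (hc : ∀ j, c j = Nat.card (M ⧸ (towerIdeal p j • ⊤ : Submodule (IwasawaAlgebra p) M)))
    {m k : ℕ} (hlt : c (m + k) < p ^ k * c m) {i : ℕ} (hi : m + k ≤ i) :
    c i = p ^ lambdaInvariant p M *
      Nat.card (LinearMap.ker (LinearMap.lsmul (IwasawaAlgebra p) M (p : IwasawaAlgebra p))) := by
  letI : Module ℤ_[p] M := Module.compHom M (algebraMap ℤ_[p] (IwasawaAlgebra p))
  haveI : IsScalarTower ℤ_[p] (IwasawaAlgebra p) M := IsScalarTower.of_compHom ℤ_[p] _ M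
  have h := finite_modP_and_natCard_eq_of_lt p c hc hlt
  haveI : Module.Finite ℤ_[p] M := moduleFinite_padicInt_of_finite_modP p h.1
  have hpp : ∀ x : M, (p : ℤ_[p]) • x = (p : IwasawaAlgebra p) • x := fun x => by
    rw [← map_natCast (algebraMap ℤ_[p] (IwasawaAlgebra p)) p, algebraMap_smul]
  have hker : Nat.card (LinearMap.ker (LinearMap.lsmul ℤ_[p] M (p : ℤ_[p]))) =
      Nat.card (LinearMap.ker (LinearMap.lsmul (IwasawaAlgebra p) M (p : IwasawaAlgebra p))) := by
    refine Nat.card_congr (Equiv.subtypeEquivRight fun x => ?_)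
    rw [LinearMap.mem_ker, LinearMap.mem_ker, LinearMap.lsmul_apply, LinearMap.lsmul_apply, hpp]
  rw [h.2 i hi, ← natCard_quotient_span_p_eq p, LambdaLowerBound.span_smul_top_eq_range_lsmul p M,
    LambdaLowerBound.natCard_quotient_eq_pow_lambdaInvariant_mul_natCard_ker p M, hker]

/-- Layer form: sub-maximal growth between layers `n` and `n+1` ⇒ `L (n+1) = p^{λ(X)} · #X[p]` (and `= L n'` for all `n' ≥ n+1`).
[cite: Washington1997, §13.2] -/
theorem natCard_layer_pow_eq_pow_lambdaInvariant_mul_of_lt (c : ℕ → ℕ)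
    (hc : ∀ j, c j = Nat.card (M ⧸ (towerIdeal p j • ⊤ : Submodule (IwasawaAlgebra p) M))) {n : ℕ}
    (hlt : c (p ^ (n + 1)) < p ^ (p ^ (n + 1) - p ^ n) * c (p ^ n)) :
    c (p ^ (n + 1)) = p ^ lambdaInvariant p M *
      Nat.card (LinearMap.ker (LinearMap.lsmul (IwasawaAlgebra p) M (p : IwasawaAlgebra p))) := by
  have hle : p ^ n ≤ p ^ (n + 1) := Nat.pow_le_pow_right hp.out.one_lt.le (Nat.le_succ n)
  have hlt' : c (p ^ n + (p ^ (n + 1) - p ^ n)) < p ^ (p ^ (n + 1) - p ^ n) * c (p ^ n) := by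
    rwa [Nat.add_sub_cancel' hle]
  have h := natCard_layer_eq_pow_lambdaInvariant_mul_of_lt p c hc hlt' (i := p ^ (n + 1)) (by rw [Nat.add_sub_cancel' hle])
  exact h

end Frozen

end Summit.BirchSwinnertonDyer.BirchSwinnertonDyer.Theorems.SignedMuAtTwo.TowerStaircase
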